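import Summits.CriticalPhenomena.SAWScalingLimit.Theorems.SAWRenewalTightnessTightIdentificationGlue
import Summits.CriticalPhenomena.SAWScalingLimit.Theses.SAWFrontierHomotopy

/-!
# Route `SAWFrontierHomotopy`: the tightness–identification glue

Item `stmt-CriticalPhenomena-11216` (`TightIdentificationGlue : SubseqIdentification →
(eventual set-level tightness of the pushed critical SAW laws) → SAWScalingLimit`), immediate
from `saw_convergesInLawToSLE_of_isTightMeasureSet_image` of
`SAWRenewalTightnessTightIdentificationGlue.lean`.

## References

* P. Billingsley, *Convergence of Probability Measures*, 2nd ed. (1999), Thm. 5.1 and its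
  Corollary [BillingsleyCPM1999].
-/

noncomputable section

namespace Summit.CriticalPhenomena.SAWScalingLimit.Theorems

/-- **Item `stmt-CriticalPhenomena-11216` (`SAWFrontierHomotopy.TightIdentificationGlue`).**
Identification of every subsequential weak limit as the chordal SLE_{8/3} law and eventual
tightness (`∃ δ₀ > 0`, `IsTightMeasureSet` of the pushed laws for `δ ∈ (0, δ₀]`) imply the
conjunct `SAWScalingLimit` (`saw_convergesInLawToSLE_of_isTightMeasureSet_image`).
[cite: BillingsleyCPM1999, Thm. 5.1, Corollary] -/
theorem frontierHomotopy_tightIdentificationGlue_proof :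
    Theses.SAWFrontierHomotopy.TightIdentificationGlue := by
  intro hI hT D a b hab
  obtain ⟨δ₀, hδ₀, htight⟩ := hT D a b hab
  refine saw_convergesInLawToSLE_of_isTightMeasureSet_image hab hδ₀ htight ?_
  rintro μ hμ ⟨s, hs, hlim⟩
  exact hI D a b hab s μ hs hμ hlim

end Summit.CriticalPhenomena.SAWScalingLimit.Theorems
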